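import Literature.NumberTheory.Rogawski1990.EndoscopicStableTwistFamily      -- ★ FILE 3 (this seat): `exists_stableTwistAut_haar_dichotomy`
import HarnessLib

/-!
# The stable twist automorphism of `H_v`, III: the CLASS TRANSVERSAL `{s}` ∕ `{s, e s}` of the stable class of a `G`-regular `s`, uniformly along each Cartan
# subgroup — the `m ∕ hclasses` letters of the weighted fibre count (Rogawski 1990, §12.5 Lemma 12.5.1 p. 183; §3.6 pp. 31–32)

Topic `NumberTheory/Rogawski1990`; namespace `Literature.NumberTheory.Rogawski1990`.  THEOREMS ONLY (no definition, no instance, no notation, no named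
fact, no `sorry`).  Cell `pub/hodgecm-mathlib`, crux H413 = stmt-HodgeConjecture-24833, ROAD «UP-TR» (holder F0P3-p02 (g23), board v2∕v3) brick **(H6a′) TWIST-MAPS**,
adapter FILE 4 (hand F0P3a-p09 (g11)): the by-shape binders `m ∕ hclasses` of ★ (N5) `Literature.GroupTheory.StableFibre.weighted_fibre_sum_eq` ∕ ★ (P3)
`F0P3cStCharTSUpTrClaimP.finsum_upSummand_eq_weightedSum` DISCHARGED from ★ FILE 3, token for token.  HONEST LABEL: count-neutral; HC_CM is proved only modulo the
printed citations until rung 0 closes.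

THE MATHEMATICS.  ★ FILE 3 gives the automorphism `e` of `H_v` and, along every Cartan subgroup `T = Z_H(γ₀)` (`γ₀` `G`-regular), the dichotomy: all `G`-regular
`s ∈ T` have `e s ∼_H s` (one class in the stable class), or all have `e s ≁_H s` (two classes `⟦s⟧ ≠ ⟦e s⟧`).  Hence the stable class of a `G`-regular `s ∈ T` has the
TRANSVERSAL `C = {s}` resp. `C = {s, e s}` by `H_v`-conjugacy classes, of size `m T ∈ {1, 2}` depending on `T` only — print's `|𝔇(T_H∕F)| ∈ {1, 2}` [§3.6], the class count
entering the weights `[N_H(T_H):T_H]⁻¹ · |𝔇(T_H∕F)|⁻¹` of [Lemma 12.5.1].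

* **`exists_stableTwistAut_transversal`** — `∃ e u (m : Subgroup H_v → ℕ)` with FILE 3's clauses (1)–(5), the per-Cartan dichotomy KEYED BY `m T ∈ {1, 2}` (the `nT ∕ hn` letters of
  ★ (H6b′) SWIFH), and for every Cartan `T = Z_H(γ₀)` and every `G`-regular `s ∈ T` a `Finset` `C` with `(∀ x ∈ C, s ∼_st x)`, `C` pairwise non-conjugate, every stable conjugate of `s` conjugate INTO `C`, `C.card = m T`,
  and `C = {s}` ∨ `C = {s, e s}` (as membership characterisations) — the (N5) `hclasses` letters verbatim at `st := IsLocalStablyConjH L v`.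

## References
* [Rogawski1990] J. D. Rogawski, *Automorphic Representations of Unitary Groups in Three Variables*, Ann. of Math. Stud. 123 (1990), §3.6 pp. 31–32,
  §12.5 Lemma 12.5.1 p. 183.
* [LanglandsShelstad1987] R. P. Langlands, D. Shelstad, *On the definition of transfer factors*, Math. Ann. 278 (1987), §1.3.
-/

set_option autoImplicit false

noncomputable section

open NumberField IsDedekindDomain Matrix MeasureTheory
open scoped MatrixGroups

namespace Literature.NumberTheory.Rogawski1990

open Literature.NumberTheory.Automorphic Literature.NumberTheory.Automorphic.UnitaryGroup Literature.NumberTheory.GaloisRepresentations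
open Literature.AlgebraicGeometry.ShimuraVarieties (unitaryGroup mem_unitaryGroup_iff)

section Transversal

variable (L : Type) [Field L] [NumberField L] [IsCMField L] (v : HeightOneSpectrum (𝓞 ↥(maximalRealSubfield L)))

/-- `a ∈ Z(a)`. [folklore] -/
private theorem mem_centralizer_singleton_self' {M : Type*} [Group M] (a : M) : a ∈ Subgroup.centralizer ({a} : Set M) :=
  Subgroup.mem_centralizer_iff.2 fun b hb => by rw [Set.mem_singleton_iff.1 hb]

/-- **THE CLASS TRANSVERSAL OF THE STABLE CLASS, UNIFORM ALONG EACH CARTAN SUBGROUP** (the `m ∕ hclasses` letters of the weighted fibre count).  At a non-split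
place `v`: `∃ e u m` with (1) `(e a).2 = a.2`, (2) `e a ∼_st a`, (3) `e (e a) = u a u⁻¹`, (4) `e` preserves `G`-regularity, (5) `e` preserves every right-invariant Haar
measure, (6) the per-Cartan dichotomy of ★ FILE 3 KEYED BY `m`: on `T = Z_H(γ₀)` (`γ₀` `G`-regular) either `m T = 1` and all `G`-regular `s ∈ T` have `e s ∼_H s` (class set `{⟦s⟧}`),
or `m T = 2` and all have `e s ≁_H s` (class set `{⟦s⟧, ⟦e s⟧}`); (7) on such `T`, every `G`-regular `s ∈ T` has
a transversal `C` of its stable class by `H_v`-conjugacy classes — `∀ x ∈ C, s ∼_st x`, pairwise non-conjugate, exhaustive up to conjugacy, `C.card = m T`, `C = {s}` or `{s, e s}`.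
[cite: Rogawski1990, §3.6 pp. 31–32; §12.5 Lemma 12.5.1 p. 183] [cite: LanglandsShelstad1987, §1.3] -/
theorem exists_stableTwistAut_transversal (w : PlacesOver L v) (hw : IsCMField.complexConj L • w.1 = w.1)
    [MeasurableSpace ((cmDatum L 2 (Matrix.of fun i j : Fin 2 => if i.val + j.val + 1 = 2 then (1 : L) else 0)).Local v × (cmDatum L 1 (Matrix.of fun i j : Fin 1 => if i.val + j.val + 1 = 1 then (1 : L) else 0)).Local v)] [BorelSpace ((cmDatum L 2 (Matrix.of fun i j : Fin 2 => if i.val + j.val + 1 = 2 then (1 : L) else 0)).Local v × (cmDatum L 1 (Matrix.of fun i j : Fin 1 => if i.val + j.val + 1 = 1 then (1 : L) else 0)).Local v)] :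
    ∃ (e : ((cmDatum L 2 (Matrix.of fun i j : Fin 2 => if i.val + j.val + 1 = 2 then (1 : L) else 0)).Local v × (cmDatum L 1 (Matrix.of fun i j : Fin 1 => if i.val + j.val + 1 = 1 then (1 : L) else 0)).Local v) ≃ₜ* ((cmDatum L 2 (Matrix.of fun i j : Fin 2 => if i.val + j.val + 1 = 2 then (1 : L) else 0)).Local v × (cmDatum L 1 (Matrix.of fun i j : Fin 1 => if i.val + j.val + 1 = 1 then (1 : L) else 0)).Local v)) (u : ((cmDatum L 2 (Matrix.of fun i j : Fin 2 => if i.val + j.val + 1 = 2 then (1 : L) else 0)).Local v × (cmDatum L 1 (Matrix.of fun i j : Fin 1 => if i.val + j.val + 1 = 1 then (1 : L) else 0)).Local v)) (m : Subgroup ((cmDatum L 2 (Matrix.of fun i j : Fin 2 => if i.val + j.val + 1 = 2 then (1 : L) else 0)).Local v × (cmDatum L 1 (Matrix.of fun i j : Fin 1 => if i.val + j.val + 1 = 1 then (1 : L) else 0)).Local v) → ℕ),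
      (∀ a : ((cmDatum L 2 (Matrix.of fun i j : Fin 2 => if i.val + j.val + 1 = 2 then (1 : L) else 0)).Local v × (cmDatum L 1 (Matrix.of fun i j : Fin 1 => if i.val + j.val + 1 = 1 then (1 : L) else 0)).Local v), (e a).2 = a.2) ∧
      (∀ a : ((cmDatum L 2 (Matrix.of fun i j : Fin 2 => if i.val + j.val + 1 = 2 then (1 : L) else 0)).Local v × (cmDatum L 1 (Matrix.of fun i j : Fin 1 => if i.val + j.val + 1 = 1 then (1 : L) else 0)).Local v), IsLocalStablyConjH L v a (e a)) ∧
      (∀ a : ((cmDatum L 2 (Matrix.of fun i j : Fin 2 => if i.val + j.val + 1 = 2 then (1 : L) else 0)).Local v × (cmDatum L 1 (Matrix.of fun i j : Fin 1 => if i.val + j.val + 1 = 1 then (1 : L) else 0)).Local v), e (e a) = u * a * u⁻¹) ∧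
      (∀ a : ((cmDatum L 2 (Matrix.of fun i j : Fin 2 => if i.val + j.val + 1 = 2 then (1 : L) else 0)).Local v × (cmDatum L 1 (Matrix.of fun i j : Fin 1 => if i.val + j.val + 1 = 1 then (1 : L) else 0)).Local v), IsLocalGRegular L v (e a) ↔ IsLocalGRegular L v a) ∧
      (∀ (ν : Measure ((cmDatum L 2 (Matrix.of fun i j : Fin 2 => if i.val + j.val + 1 = 2 then (1 : L) else 0)).Local v × (cmDatum L 1 (Matrix.of fun i j : Fin 1 => if i.val + j.val + 1 = 1 then (1 : L) else 0)).Local v)) [ν.IsHaarMeasure] [ν.IsMulRightInvariant], MeasurePreserving e ν ν) ∧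
      (∀ T : Subgroup ((cmDatum L 2 (Matrix.of fun i j : Fin 2 => if i.val + j.val + 1 = 2 then (1 : L) else 0)).Local v × (cmDatum L 1 (Matrix.of fun i j : Fin 1 => if i.val + j.val + 1 = 1 then (1 : L) else 0)).Local v), (∃ γ₀ : ((cmDatum L 2 (Matrix.of fun i j : Fin 2 => if i.val + j.val + 1 = 2 then (1 : L) else 0)).Local v × (cmDatum L 1 (Matrix.of fun i j : Fin 1 => if i.val + j.val + 1 = 1 then (1 : L) else 0)).Local v), IsLocalGRegular L v γ₀ ∧ T = Subgroup.centralizer ({γ₀} : Set ((cmDatum L 2 (Matrix.of fun i j : Fin 2 => if i.val + j.val + 1 = 2 then (1 : L) else 0)).Local v × (cmDatum L 1 (Matrix.of fun i j : Fin 1 => if i.val + j.val + 1 = 1 then (1 : L) else 0)).Local v))) →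
        (m T = 1 ∧ ∀ s ∈ T, IsLocalGRegular L v s →
            IsConj s (e s) ∧ {c : ConjClasses ((cmDatum L 2 (Matrix.of fun i j : Fin 2 => if i.val + j.val + 1 = 2 then (1 : L) else 0)).Local v × (cmDatum L 1 (Matrix.of fun i j : Fin 1 => if i.val + j.val + 1 = 1 then (1 : L) else 0)).Local v) | IsLocalStablyConjH L v s (Quotient.out c)} = {ConjClasses.mk s}) ∨
        (m T = 2 ∧ ∀ s ∈ T, IsLocalGRegular L v s →
            ¬ IsConj s (e s) ∧ {c : ConjClasses ((cmDatum L 2 (Matrix.of fun i j : Fin 2 => if i.val + j.val + 1 = 2 then (1 : L) else 0)).Local v × (cmDatum L 1 (Matrix.of fun i j : Fin 1 => if i.val + j.val + 1 = 1 then (1 : L) else 0)).Local v) | IsLocalStablyConjH L v s (Quotient.out c)} = {ConjClasses.mk s, ConjClasses.mk (e s)})) ∧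
      ∀ T : Subgroup ((cmDatum L 2 (Matrix.of fun i j : Fin 2 => if i.val + j.val + 1 = 2 then (1 : L) else 0)).Local v × (cmDatum L 1 (Matrix.of fun i j : Fin 1 => if i.val + j.val + 1 = 1 then (1 : L) else 0)).Local v), (∃ γ₀ : ((cmDatum L 2 (Matrix.of fun i j : Fin 2 => if i.val + j.val + 1 = 2 then (1 : L) else 0)).Local v × (cmDatum L 1 (Matrix.of fun i j : Fin 1 => if i.val + j.val + 1 = 1 then (1 : L) else 0)).Local v), IsLocalGRegular L v γ₀ ∧ T = Subgroup.centralizer ({γ₀} : Set ((cmDatum L 2 (Matrix.of fun i j : Fin 2 => if i.val + j.val + 1 = 2 then (1 : L) else 0)).Local v × (cmDatum L 1 (Matrix.of fun i j : Fin 1 => if i.val + j.val + 1 = 1 then (1 : L) else 0)).Local v))) →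
        ∀ s ∈ T, IsLocalGRegular L v s →
          ∃ C : Finset ((cmDatum L 2 (Matrix.of fun i j : Fin 2 => if i.val + j.val + 1 = 2 then (1 : L) else 0)).Local v × (cmDatum L 1 (Matrix.of fun i j : Fin 1 => if i.val + j.val + 1 = 1 then (1 : L) else 0)).Local v), (∀ x ∈ C, IsLocalStablyConjH L v s x) ∧ (∀ x ∈ C, ∀ y ∈ C, IsConj x y → x = y) ∧
            (∀ y : ((cmDatum L 2 (Matrix.of fun i j : Fin 2 => if i.val + j.val + 1 = 2 then (1 : L) else 0)).Local v × (cmDatum L 1 (Matrix.of fun i j : Fin 1 => if i.val + j.val + 1 = 1 then (1 : L) else 0)).Local v), IsLocalStablyConjH L v s y → ∃ x ∈ C, IsConj y x) ∧ C.card = m T ∧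
              ((∀ x : ((cmDatum L 2 (Matrix.of fun i j : Fin 2 => if i.val + j.val + 1 = 2 then (1 : L) else 0)).Local v × (cmDatum L 1 (Matrix.of fun i j : Fin 1 => if i.val + j.val + 1 = 1 then (1 : L) else 0)).Local v), x ∈ C ↔ x = s) ∨ (∀ x : ((cmDatum L 2 (Matrix.of fun i j : Fin 2 => if i.val + j.val + 1 = 2 then (1 : L) else 0)).Local v × (cmDatum L 1 (Matrix.of fun i j : Fin 1 => if i.val + j.val + 1 = 1 then (1 : L) else 0)).Local v), x ∈ C ↔ x = s ∨ x = e s)) := by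
  classical
  obtain ⟨e, u, h1, h2, h3, h4, h5, h6, -, h8⟩ := exists_stableTwistAut_haar_dichotomy L v w hw
  -- `m T = 1` on one-class Cartans, `2` otherwise
  have key : ∀ γ₀ : ((cmDatum L 2 (Matrix.of fun i j : Fin 2 => if i.val + j.val + 1 = 2 then (1 : L) else 0)).Local v × (cmDatum L 1 (Matrix.of fun i j : Fin 1 => if i.val + j.val + 1 = 1 then (1 : L) else 0)).Local v), IsLocalGRegular L v γ₀ →
      ((@ite ℕ (∀ s ∈ Subgroup.centralizer ({γ₀} : Set ((cmDatum L 2 (Matrix.of fun i j : Fin 2 => if i.val + j.val + 1 = 2 then (1 : L) else 0)).Local v × (cmDatum L 1 (Matrix.of fun i j : Fin 1 => if i.val + j.val + 1 = 1 then (1 : L) else 0)).Local v)), IsLocalGRegular L v s → IsConj s (e s)) (Classical.dec _) 1 2) = 1 ∧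
        ∀ s ∈ Subgroup.centralizer ({γ₀} : Set ((cmDatum L 2 (Matrix.of fun i j : Fin 2 => if i.val + j.val + 1 = 2 then (1 : L) else 0)).Local v × (cmDatum L 1 (Matrix.of fun i j : Fin 1 => if i.val + j.val + 1 = 1 then (1 : L) else 0)).Local v)), IsLocalGRegular L v s →
          IsConj s (e s) ∧ {c : ConjClasses ((cmDatum L 2 (Matrix.of fun i j : Fin 2 => if i.val + j.val + 1 = 2 then (1 : L) else 0)).Local v × (cmDatum L 1 (Matrix.of fun i j : Fin 1 => if i.val + j.val + 1 = 1 then (1 : L) else 0)).Local v) | IsLocalStablyConjH L v s (Quotient.out c)} = {ConjClasses.mk s}) ∨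
      ((@ite ℕ (∀ s ∈ Subgroup.centralizer ({γ₀} : Set ((cmDatum L 2 (Matrix.of fun i j : Fin 2 => if i.val + j.val + 1 = 2 then (1 : L) else 0)).Local v × (cmDatum L 1 (Matrix.of fun i j : Fin 1 => if i.val + j.val + 1 = 1 then (1 : L) else 0)).Local v)), IsLocalGRegular L v s → IsConj s (e s)) (Classical.dec _) 1 2) = 2 ∧
        ∀ s ∈ Subgroup.centralizer ({γ₀} : Set ((cmDatum L 2 (Matrix.of fun i j : Fin 2 => if i.val + j.val + 1 = 2 then (1 : L) else 0)).Local v × (cmDatum L 1 (Matrix.of fun i j : Fin 1 => if i.val + j.val + 1 = 1 then (1 : L) else 0)).Local v)), IsLocalGRegular L v s →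
          ¬ IsConj s (e s) ∧ {c : ConjClasses ((cmDatum L 2 (Matrix.of fun i j : Fin 2 => if i.val + j.val + 1 = 2 then (1 : L) else 0)).Local v × (cmDatum L 1 (Matrix.of fun i j : Fin 1 => if i.val + j.val + 1 = 1 then (1 : L) else 0)).Local v) | IsLocalStablyConjH L v s (Quotient.out c)} = {ConjClasses.mk s, ConjClasses.mk (e s)}) := by
    intro γ₀ hγ₀
    rcases h8 γ₀ hγ₀ with hone | htwo
    · exact Or.inl ⟨if_pos fun s hs hsreg => (hone s hs hsreg).1, hone⟩
    · exact Or.inr ⟨if_neg fun hall => (htwo γ₀ (mem_centralizer_singleton_self' γ₀) hγ₀).1 (hall γ₀ (mem_centralizer_singleton_self' γ₀) hγ₀), htwo⟩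
  refine ⟨e, u, fun T => @ite ℕ (∀ s ∈ T, IsLocalGRegular L v s → IsConj s (e s)) (Classical.dec _) 1 2, h1, h2, h3, h4, h5, ?_, ?_⟩
  · rintro T ⟨γ₀, hγ₀, rfl⟩
    exact key γ₀ hγ₀
  · rintro T ⟨γ₀, hγ₀, rfl⟩ s hs hsreg
    rcases key γ₀ hγ₀ with ⟨hm, hone⟩ | ⟨hm, htwo⟩
    · -- one class along the torus: `C = {s}`
      refine ⟨{s}, ?_, ?_, ?_, ?_, Or.inl fun x => Finset.mem_singleton⟩
      · intro x hx
        rw [Finset.mem_singleton] at hx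
        subst hx
        exact IsStablyConjH.refl _ _ _ _
      · intro x hx y hy _
        rw [Finset.mem_singleton] at hx hy
        rw [hx, hy]
      · intro y hy
        refine ⟨s, Finset.mem_singleton_self s, ?_⟩
        rcases h6 s hsreg y hy with h | h
        · exact h.symm
        · exact h.symm.trans (hone s hs hsreg).1.symm
      · rw [Finset.card_singleton]; exact hm.symm
    · -- two classes along the torus: `C = {s, e s}`
      have hnc : ¬ IsConj s (e s) := (htwo s hs hsreg).1
      have hne : s ≠ e s := fun h => hnc (by rw [← h])
      refine ⟨{s, e s}, ?_, ?_, ?_, ?_, Or.inr fun x => by rw [Finset.mem_insert, Finset.mem_singleton]⟩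
      · intro x hx
        rw [Finset.mem_insert, Finset.mem_singleton] at hx
        rcases hx with rfl | rfl
        · exact IsStablyConjH.refl _ _ _ _
        · exact h2 _
      · intro x hx y hy hxy
        rw [Finset.mem_insert, Finset.mem_singleton] at hx hy
        rcases hx with rfl | rfl <;> rcases hy with rfl | rfl
        · rfl
        · exact absurd hxy hnc
        · exact absurd hxy.symm hnc
        · rfl
      · intro y hy
        rcases h6 s hsreg y hy with h | h
        · exact ⟨s, Finset.mem_insert_self _ _, h.symm⟩
        · exact ⟨e s, Finset.mem_insert_of_mem (Finset.mem_singleton_self _), h.symm⟩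
      · rw [Finset.card_pair hne]; exact hm.symm

end Transversal

end Literature.NumberTheory.Rogawski1990

end
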